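import Summits.HodgeConjecture.HodgeConjecture.Theorems.Ring2HypothesesDescentMotivatedPullbackLift
import Summits.HodgeConjecture.HodgeConjecture.Theorems.Ring2HypothesesDescentMotivatedStarAdjoint
import Summits.HodgeConjecture.HodgeConjecture.Theorems.Ring2HypothesesDescentMotivatedCupProduct
import Literature.AlgebraicGeometry.HodgeTheory.DominatedByPowersHodgeConjecture
import HarnessLib

/-!
# Ring 2 hypotheses, descent face — ANDRÉ'S SEMISIMPLICITY LIFT ALONG ALGEBRAIC CORRESPONDENCES (real carriers),
# and the DESCENT of «motivated ⟹ algebraic» along Arapura's domination by powers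

research route conditional on HC_CM; not a corollary; Q11.4-sentence-2 already refuted in dim ≥ 3.
Cell `pub-hodge-ring2` (Hodge ladder STAGE 3), seat `ring2-b05` (binder row b05
`Ring2.Hypotheses.MotivatedImpliesAlgebraicAV`, `Ring2HypothesesDescent.lean` :177), gen 40. `HC_CM`
(`Theses.RankFourFaces.CMAbelianHodge`) does not occur in this file; nothing here proves a case of the Hodge
conjecture; no binder of `BINDER-OWNERS.md` is discharged; row b05 stays OPEN and is not asserted.

André 1996, Thm. 0.4 (p. 7): the category of motives built from motivated correspondences is abelian SEMISIMPLE;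
§5.1 (p. 25) uses it to LIFT a motivated class along a pull-back `j^*` («en fait, `ξ_s` provient d'un cycle motivé
sur `X̄`») — the tree's leaf (A3), discharged on the real carriers by gen 36 (`Andre1996_exists_motivated_of_motivated_pullback_holds`,
non-degeneracy of the cup pairing on `A_mot`, Prop. 3.3, in place of the category). Arapura 2006 (Adv. Math. 207),
Lemma 4.2 with Lemma 1.1: if `Y` is motivated by `X` («there exists a morphism `⊕ [X]^{⊗n}(m) → [Y]` in `M_A(X)`
inducing a surjection on cohomology») and a conjecture among `D`, `B`, `HC`, `GHC` holds for all powers of `X`, it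
holds for `Y` — proof: `[Y]` is a direct summand of `Ξ = ⊕ X^{nᵢ}(jᵢ)`, lift the class to `Ξ` with zero
complementary component. THIS FILE proves the common engine of both on the real carriers, for an ARBITRARY
algebraic correspondence instead of `j^*`, and adds to Arapura's list the clause «`A_mot = A`» (André's motivated
classes, ALL pieces) in the algebraic form of domination used by the tree (`HodgeTheory.IsDominatedByPowers`,
Literature `DominatedByPowersHodgeConjecture`; the Hodge-class clause is the tree's
`CorCM.Stage4.hodgeConjectureFor_of_isDominatedByPowers`):

* §0 `eq_zero_of_kroneckerPairing_eq_zero_of_orientation` — `⟨v, [V(ℂ)]_ν⟩ = 0 ⟹ v = 0` on the top line, for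
  ANY `ℂ`-orientation `ν` (the orientations inside `IsAlgebraicCorrespondence` are arbitrary).
* §1 `cupPairing_corrClassAction_eq_cupPairing_gysinMap_snd` — THE ADJOINT CLASS: for `γ ∈ H^{2e}((V ⊗ Y)(ℂ))`,
  `⟨γ_*(y) ∪ b, [V]_ν⟩ = ⟨snd_*(γ ∪ fst^* b) ∪ y, [Y]⟩` (Fulton App. B (5)–(6) twice: `fst_*` and `snd_*` are the
  transposes of `fst^*`, `snd^*`); for `γ` algebraic and `b` motivated the adjoint class `snd_*(γ ∪ fst^* b)` is
  MOTIVATED (André Prop. 2.1: `fst^*`, `γ ∪ ·`, `snd_*` preserve `A_mot`).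
* §2 `cupProduct_corrClassAction_eq_zero_of_forall_motivated` — if a motivated `b` on `V` is cup-orthogonal to
  `T(A_mot(Y))` for an algebraic correspondence `T`, it is cup-orthogonal to the WHOLE range `T(H(Y))` (the adjoint
  class is motivated and orthogonal to `A_mot(Y)`, hence `0` by Prop. 3.3 — gen 36's `nondegenerate_motivatedClasses`).
* §3 **`exists_mem_motivatedClasses_map_eq_of_isAlgebraicCorrespondence` — THE LIFT: a motivated class of `V`
  lying in the range of an algebraic correspondence `T : H^{2p'}(Y) → H^{2p}(V)` is `T` of a MOTIVATED class of
  `Y`** (`W^⊥⊥ = W` inside the non-degenerately paired `A_motᵖ(V) × A_mot^{m-p}(V)`, gen 36's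
  `mem_of_forall_orthogonal`). The case `T = j^*` is leaf (A3) of André's deformation theorem.
* §4 **`motivatedClasses_le_span_of_isDominatedByPowers` — if `V` is dominated by the powers of `X`
  (`IsDominatedByPowers m V d X`), every motivated class of `V` is a sum `Σ Tᵢ(yᵢ)` with `Tᵢ` algebraic
  correspondences from powers `X^{eᵢ}` and `yᵢ` MOTIVATED on `X^{eᵢ}`** — the realisation-level content of
  «`[V] ∈ M_A(X)` is a direct summand of `⊕[X^{eᵢ}](jᵢ)`»; hence **`motivatedClasses_le_algebraicClasses_of_isDominatedByPowers`
  — «`A_mot = A` on all powers of `X`» ⟹ «`A_mot = A` on `V`»** (Arapura's Lemma 4.2 with this clause), and the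
  positive-powers form (`X⁰ = Spec ℂ` carries no motivated class of positive codimension).

HONEST COLUMN. No definition, no named fact (new or displayed), no sorry; fact-free kernel theorems about André's
`motivatedClasses` on the real carriers; the row-level readings (row b05 ⟺ curve powers ⟺ Arapura's strict abelian
class) are in the companion `Ring2HypothesesDescentMotivatedDomination.lean`. Not claimed: anything categorical
(no category of motives in the tree), Arapura's WEAK motivation, the clauses `D`/`B`/`GHC`.

PRESEARCH: [corpus: `paper:arxiv-math_0501348` Arapura 2006 §1 Lemma 1.1, §4 Thm. 4.1 / Lemma 4.2 / Cor. 4.4,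
re-opened this session] — the clause «`A_mot = A`» is not among the printed ones (`D`, `B`, `HC`, `GHC`; `AC` for weak
motivation); [corpus: `paper:doi-10-1007-bf02698643` André 1996 Thm. 0.4 p. 7, Prop. 3.3 pp. 21–22, §5.1 p. 25];
corpus hybrid/vector + galaxy (all stars) «motivated by an Abelian variety|motivated by a curve|cycles motivés sont
algébriques»: no statement of §3–§4 in print found — certification by assembly, no novelty in print claimed.

References (bib keys): Andre1996Motifs (Thm. 0.4 p. 7, Prop. 2.1 pp. 14–15, Prop. 3.3 pp. 21–22, §5.1 p. 25),
Arapura2006 (§1 Lemma 1.1, §4 Thm. 4.1, Lemma 4.2, Cor. 4.4), FultonYoungTableaux1997 (App. B §B.1 (5)–(6)),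
VoisinHodgeII2003 (proof of Thm. 10.17 (10.7), Prop. 9.20–9.21), HatcherAT2002 (§3.2 Thm. 3.2, §3.3 Thm. 3.26, Prop. 3.38).
-/

noncomputable section

-- every declaration of this problem lives in `Summit.HodgeConjecture.HodgeConjecture.…` (summit = sub-problem)
set_option linter.dupNamespace false

open CategoryTheory AlgebraicGeometry MonoidalCategory CartesianMonoidalCategory
open Literature.AlgebraicTopology.SingularHomology Literature.Geometry.Kaehler
open Literature.AlgebraicGeometry Literature.AlgebraicGeometry.Motives
  Literature.AlgebraicGeometry.HodgeTheory

namespace Summit.HodgeConjecture.HodgeConjecture.Theorems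

variable {m n : ℕ} {V Y : SchemeOver ℂ}

/-! ## §0 Top-degree Kronecker injectivity for an arbitrary orientation -/

/-- **`⟨v, [V(ℂ)]_ν⟩ = 0 ⟹ v = 0` on the top line `H^{2m}(V(ℂ); ℂ)`, for ANY `ℂ`-orientation `ν`** of the
connected closed manifold `V(ℂ)` (`V` smooth projective of dimension `m`): the Kronecker map
`H^{2m} → Hom(H_{2m}, ℂ)` is injective over a field (Hatcher Thm. 3.2) and `H_{2m}(V(ℂ); ℂ) = ℂ · [V(ℂ)]_ν`
(Hatcher Thm. 3.26; the tree's `exists_eq_smul_fundamentalClass_of_connectedSpace`). The tree's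
`eq_zero_of_kroneckerPairing_fundamentalClass_eq_zero` is the case of an orientation FAMILY; the orientations packed
in `HodgeTheory.IsAlgebraicCorrespondence` are arbitrary. [cite: HatcherAT2002, §3.2 Thm. 3.2 and §3.3 Thm. 3.26] -/
theorem eq_zero_of_kroneckerPairing_eq_zero_of_orientation (hV : IsSmoothProjective m V)
    (ν : HomologicalOrientation ℂ (ComplexPoints V) (2 * m)) {v : complexBetti V (2 * m)}
    (hv : kroneckerPairing ℂ ℂ (ComplexPoints V) (2 * m) v ν.fundamentalClass = 0) : v = 0 := by
  letI := hV.chartedSpace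
  haveI := ComplexPoints.compactSpace_of_isSmoothProjective hV
  haveI := ComplexPoints.t2Space_of_isSmoothProjective hV
  haveI := connectedSpace_complexPoints hV
  apply kroneckerPairing_injective_of_field ℂ (ComplexPoints V) (2 * m)
  rw [map_zero]
  refine LinearMap.ext fun z ↦ ?_
  obtain ⟨r, rfl⟩ := exists_eq_smul_fundamentalClass_of_connectedSpace ν z
  rw [map_smul, hv, smul_zero, LinearMap.zero_apply]

/-! ## §1 The adjoint class of a correspondence action -/

/-- **The adjoint class.** `V`, `Y` smooth projective of dimensions `m`, `n`; `μ` an orientation of `(V ⊗ Y)(ℂ)`,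
`ν` an orientation of `V(ℂ)` with Poincaré duality; `γ ∈ H^{2e}((V ⊗ Y)(ℂ); ℂ)`, `y ∈ H^{2p'}(Y(ℂ))`,
`b ∈ H^{2r}(V(ℂ))`, `2p' + 2e = 2p + 2n`, `p + r = m`, `p' + p'' = n`. Then
`⟨γ_*(y) ∪ b, [V]_ν⟩ = ⟨snd_*(γ ∪ fst^* b) ∪ y, [Y]⟩`, where `γ_* = fst_*(snd^*(·) ∪ γ)`
(`HodgeTheory.corrClassAction μ ν`) and `snd_* : H^{2(p''+m)}((V ⊗ Y)(ℂ)) → H^{2p''}(Y(ℂ))` is the Gysin map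
for `μ` and the complex orientation of `Y(ℂ)`. Proof: `⟨fst_*(snd^* y ∪ γ) ∪ b, [V]⟩ = ⟨γ ∪ (fst^* b ∪ snd^* y), [V ⊗ Y]⟩`
(the tree's `cupPairing_corrClassAction`, Fulton App. B (6) for `fst`), `= ⟨(γ ∪ fst^* b) ∪ snd^* y, [V ⊗ Y]⟩`
(associativity), `= ⟨snd_*(γ ∪ fst^* b) ∪ y, [Y]⟩` (Fulton App. B (6) for `snd`, the tree's `cupPairing_gysinMap`);
all degrees are even, so no sign. [cite: FultonYoungTableaux1997, Appendix B §B.1 (5)–(6)]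
[cite: VoisinHodgeII2003, proof of Thm. 10.17 (10.7)] [cite: HatcherAT2002, §3.3 p. 249] -/
theorem cupPairing_corrClassAction_eq_cupPairing_gysinMap_snd (hY : IsSmoothProjective n Y)
    (μ : HomologicalOrientation ℂ (ComplexPoints (V ⊗ Y)) (2 * (m + n)))
    (ν : HomologicalOrientation ℂ (ComplexPoints V) (2 * m)) (hν : ν.HasPoincareDuality)
    {e p p' r p'' : ℕ} (hab : 2 * p' + 2 * e = 2 * p + 2 * n) (hq : 2 * p + 2 * r = 2 * m)
    (h₁ : 2 * e + 2 * r = 2 * (p'' + m)) (H₁ : 2 * (p'' + m) + 2 * p' = 2 * (m + n))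
    (H₂ : 2 * p'' + 2 * p' = 2 * n) (γ : complexBetti (V ⊗ Y) (2 * e)) (y : complexBetti Y (2 * p'))
    (b : complexBetti V (2 * r)) :
    cupPairing ν hq (corrClassAction μ ν hab hq γ y) b =
      cupPairing (complexOrientationFamily hY) H₂
        (gysinMap μ (complexOrientationFamily hY) (AlgPoints.mapContinuous (L := ℂ) (snd V Y)) H₁ H₂
          (cupProduct h₁ γ (complexBetti.map (fst V Y) (2 * r) b))) y := by
  have h : 2 * e + (2 * r + 2 * p') = 2 * (m + n) := by omega
  rw [cupPairing_corrClassAction μ ν hν hab hq (rfl : 2 * r + 2 * p' = 2 * r + 2 * p') h γ y b,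
    show ((-1 : ℂ) ^ (2 * p' * (2 * r))) = 1 by
      rw [show 2 * p' * (2 * r) = 2 * (p' * (2 * r)) by ring, pow_mul, neg_one_sq, one_pow], one_smul,
    cupPairing_gysinMap (hasPoincareDuality_complexOrientationFamily hY)
      (AlgPoints.mapContinuous (L := ℂ) (snd V Y)) H₁ H₂ _ y,
    cupPairing_apply, cupPairing_apply, cupProduct_assoc h₁ (rfl : 2 * r + 2 * p' = 2 * r + 2 * p') H₁ h]

/-- **The adjoint class of an ALGEBRAIC correspondence at a MOTIVATED class is motivated**: for `γ` algebraic on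
`V ⊗ Y` and `b ∈ A_motʳ(V)_ℂ`, `snd_*(γ ∪ fst^* b) ∈ A_mot^{p''}(Y)_ℂ` — `fst^* b` is motivated (André Prop. 2.1 (ii),
gen 34's `map_fst_mem_motivatedClasses`), `γ ∪ ·` preserves motivated classes (Prop. 2.1 (i), gen 35's
`cupProduct_mem_motivatedClasses_of_algebraic_left`), and so does `snd_*` for any orientations with Poincaré duality
(Prop. 2.1 (ii), the tree's `gysinMap_snd_mem_motivatedClasses`). [cite: Andre1996Motifs, Prop. 2.1 (pp. 14–15)] -/
theorem gysinMap_snd_cupProduct_map_fst_mem_motivatedClasses (hV : IsSmoothProjective m V)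
    (hY : IsSmoothProjective n Y) (μ : HomologicalOrientation ℂ (ComplexPoints (V ⊗ Y)) (2 * (m + n)))
    (hμ : μ.HasPoincareDuality) {e r p' p'' : ℕ} (h₁ : 2 * e + 2 * r = 2 * (p'' + m))
    (H₁ : 2 * (p'' + m) + 2 * p' = 2 * (m + n)) (H₂ : 2 * p'' + 2 * p' = 2 * n)
    {γ : complexBetti (V ⊗ Y) (2 * e)} (hγ : γ ∈ algebraicClasses (V ⊗ Y) e) {b : complexBetti V (2 * r)}
    (hb : b ∈ motivatedClasses m V r) :
    gysinMap μ (complexOrientationFamily hY) (AlgPoints.mapContinuous (L := ℂ) (snd V Y)) H₁ H₂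
        (cupProduct h₁ γ (complexBetti.map (fst V Y) (2 * r) b)) ∈ motivatedClasses n Y p'' := by
  have hVY : IsSmoothProjective (m + n) (V ⊗ Y) := IsSmoothProjective.tensor_holds hV hY
  have hfst : complexBetti.map (fst V Y) (2 * r) b ∈ motivatedClasses (m + n) (V ⊗ Y) r :=
    map_fst_mem_motivatedClasses hV hY r hb
  have hcup : cupProduct h₁ γ (complexBetti.map (fst V Y) (2 * r) b) ∈
      motivatedClasses (m + n) (V ⊗ Y) (p'' + m) :=
    cupProduct_mem_motivatedClasses_of_algebraic_left hVY h₁ hγ hfst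
  exact gysinMap_snd_mem_motivatedClasses hV hY μ (complexOrientationFamily hY) hμ
    (hasPoincareDuality_complexOrientationFamily hY) H₁ H₂ hcup

/-! ## §2 Orthogonality propagates from `T(A_mot(Y))` to the whole range `T(H(Y))` -/

/-- **If a motivated class `b ∈ A_motʳ(V)_ℂ` (`p + r = m`) is cup-orthogonal to `T(A_mot^{p'}(Y)_ℂ)` for an algebraic
correspondence `T : H^{2p'}(Y(ℂ)) → H^{2p}(V(ℂ))`, then `T(y₀) ∪ b = 0` for EVERY `y₀ ∈ H^{2p'}(Y(ℂ); ℂ)`.** With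
`T = γ_*`: the adjoint class `s = snd_*(γ ∪ fst^* b) ∈ A_mot^{n-p'}(Y)` (§1) satisfies `⟨s ∪ y, [Y]⟩ = ⟨T y ∪ b, [V]⟩ = 0`
for all motivated `y`, hence `s = 0` by the non-degeneracy of the cup pairing on motivated classes (André Prop. 3.3,
gen 36's `nondegenerate_motivatedClasses`), hence `⟨T y₀ ∪ b, [V]_ν⟩ = ⟨s ∪ y₀, [Y]⟩ = 0` for all `y₀`, and
`T y₀ ∪ b = 0` (§0). [cite: Andre1996Motifs, Prop. 3.3 (pp. 21–22) and Thm. 0.4 (p. 7)]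
[cite: FultonYoungTableaux1997, Appendix B §B.1 (5)–(6)] -/
theorem cupProduct_corrClassAction_eq_zero_of_forall_motivated (hV : IsSmoothProjective m V)
    (hY : IsSmoothProjective n Y) {p p' r : ℕ} (hpr : p + r = m)
    {T : complexBetti Y (2 * p') →ₗ[ℂ] complexBetti V (2 * p)} (hT : IsAlgebraicCorrespondence m n V Y T)
    {b : complexBetti V (2 * r)} (hb : b ∈ motivatedClasses m V r)
    (horth : ∀ y ∈ motivatedClasses n Y p', cupProduct (show 2 * p + 2 * r = 2 * m by omega) (T y) b = 0)
    (y₀ : complexBetti Y (2 * p')) : cupProduct (show 2 * p + 2 * r = 2 * m by omega) (T y₀) b = 0 := by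
  classical
  -- no classes of degree `2p' > 2n`
  by_cases hp'n : n < p'
  · haveI := subsingleton_complexBetti hY (show 2 * n < 2 * p' by omega)
    rw [Subsingleton.elim y₀ 0, map_zero, map_zero, LinearMap.zero_apply]
  obtain ⟨p'', hp''⟩ : ∃ p'', p' + p'' = n := ⟨n - p', by omega⟩
  obtain ⟨μ, ν, hμ, hν, e, q, hab, hq, γ, hγ, rfl⟩ := hT
  obtain rfl : q = 2 * r := by omega
  -- degrees of the adjoint class
  have h₁ : 2 * e + 2 * r = 2 * (p'' + m) := by omega
  have H₁ : 2 * (p'' + m) + 2 * p' = 2 * (m + n) := by omega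
  have H₂ : 2 * p'' + 2 * p' = 2 * n := by omega
  -- the adjoint class is motivated …
  have hs := gysinMap_snd_cupProduct_map_fst_mem_motivatedClasses hV hY μ hμ h₁ H₁ H₂ hγ hb
  -- … and cup-orthogonal to `A_mot^{p'}(Y)`, hence zero
  have hs0 : gysinMap μ (complexOrientationFamily hY) (AlgPoints.mapContinuous (L := ℂ) (snd V Y)) H₁ H₂
      (cupProduct h₁ γ (complexBetti.map (fst V Y) (2 * r) b)) = 0 := by
    refine (nondegenerate_motivatedClasses hY (show p'' + p' = n by omega)).1 _ hs fun y hy ↦ ?_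
    refine cupProduct_eq_zero_of_cupPairing_eq_zero complexOrientationFamily hY _ ?_
    rw [← cupPairing_corrClassAction_eq_cupPairing_gysinMap_snd hY μ ν hν hab hq h₁ H₁ H₂ γ y b,
      cupPairing_apply, horth y hy, map_zero, LinearMap.zero_apply]
  -- conclude for an arbitrary `y₀`
  refine eq_zero_of_kroneckerPairing_eq_zero_of_orientation hV ν ?_
  rw [← cupPairing_apply, cupPairing_corrClassAction_eq_cupPairing_gysinMap_snd hY μ ν hν hab hq h₁ H₁ H₂ γ y₀ b,
    hs0, map_zero, LinearMap.zero_apply]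

/-! ## §3 The lift: a motivated class in the range of an algebraic correspondence has a motivated preimage -/

/-- **ANDRÉ'S SEMISIMPLICITY LIFT ALONG AN ALGEBRAIC CORRESPONDENCE, on the real carriers.** For `V`, `Y` smooth
projective complex varieties of dimensions `m`, `n`, a map `T : H^{2p'}(Y(ℂ); ℂ) → H^{2p}(V(ℂ); ℂ)` induced by an
algebraic correspondence (`IsAlgebraicCorrespondence m n V Y T`) and a MOTIVATED class `c ∈ A_motᵖ(V)_ℂ` lying in the
range of `T`: there is a MOTIVATED `y ∈ A_mot^{p'}(Y)_ℂ` with `T y = c`. In print this is the semisimplicity of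
André's motives (Thm. 0.4): the image of the morphism `T` is a direct summand and a motivated class in its realisation
lifts. Here: `W := T(A_mot^{p'}(Y)) ≤ A_motᵖ(V)` (André Prop. 2.1 Corollaire, gen 34's
`map_mem_motivatedClasses_of_isAlgebraicCorrespondence`); a motivated `b` of complementary codimension orthogonal to
`W` is orthogonal to the whole range of `T` (§2), in particular to `c`; so `c ∈ W^⊥⊥ = W` (André Prop. 3.3 on `V`,
gen 36's `mem_of_forall_orthogonal`). The pull-back case `T = j^*` is leaf (A3) of André's deformation theorem
(`Andre1996_exists_motivated_of_motivated_pullback_holds`). [cite: Andre1996Motifs, Thm. 0.4 (p. 7), Prop. 3.3 (pp. 21–22) and §5.1 (p. 25)]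
[cite: Arapura2006, §4 proof of Lemma 4.2] -/
theorem exists_mem_motivatedClasses_map_eq_of_isAlgebraicCorrespondence (hV : IsSmoothProjective m V)
    (hY : IsSmoothProjective n Y) {p p' : ℕ} {T : complexBetti Y (2 * p') →ₗ[ℂ] complexBetti V (2 * p)}
    (hT : IsAlgebraicCorrespondence m n V Y T) {c : complexBetti V (2 * p)} (hc : c ∈ motivatedClasses m V p)
    (hcT : c ∈ LinearMap.range T) : ∃ y ∈ motivatedClasses n Y p', T y = c := by
  classical
  by_cases hpm : m < p
  · haveI := subsingleton_complexBetti hV (show 2 * m < 2 * p by omega)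
    exact ⟨0, Submodule.zero_mem _, Subsingleton.elim _ _⟩
  obtain ⟨r, hpr⟩ : ∃ r, p + r = m := ⟨m - p, by omega⟩
  obtain ⟨y₀, rfl⟩ := hcT
  set W : Submodule ℂ (complexBetti V (2 * p)) := (motivatedClasses n Y p').map T with hWdef
  have hWle : W ≤ motivatedClasses m V p := by
    rintro _ ⟨y, hy, rfl⟩
    exact Ring2.Hypotheses.map_mem_motivatedClasses_of_isAlgebraicCorrespondence hV hY hT hy
  haveI := finite_complexBetti hV (2 * p)
  haveI := finite_complexBetti hV (2 * r)
  haveI := finite_complexBetti hV (2 * m)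
  obtain ⟨hD₁, hD₂⟩ := nondegenerate_motivatedClasses hV hpr
  have hmem : T y₀ ∈ W :=
    mem_of_forall_orthogonal (Ring2.Hypotheses.finrank_complexBetti_top hV)
      (cupProduct (show 2 * p + 2 * r = 2 * m by omega)) (motivatedClasses m V p) (motivatedClasses m V r) hD₁ hD₂
      hWle hc fun b hb hbW ↦
        cupProduct_corrClassAction_eq_zero_of_forall_motivated hV hY hpr hT hb (fun y hy ↦ hbW _ ⟨y, hy, rfl⟩) y₀
  obtain ⟨y, hy, hyc⟩ := hmem
  exact ⟨y, hy, hyc⟩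

/-- **Submodule form**: `A_motᵖ(V) ∩ T(H^{2p'}(Y)) = T(A_mot^{p'}(Y))` for an algebraic correspondence `T` (`≥` is
André Prop. 2.1 Corollaire). [cite: Andre1996Motifs, Thm. 0.4 (p. 7) and Prop. 2.1 Corollaire (p. 15)] -/
theorem motivatedClasses_inf_range_eq_map_of_isAlgebraicCorrespondence (hV : IsSmoothProjective m V)
    (hY : IsSmoothProjective n Y) {p p' : ℕ} {T : complexBetti Y (2 * p') →ₗ[ℂ] complexBetti V (2 * p)}
    (hT : IsAlgebraicCorrespondence m n V Y T) :
    motivatedClasses m V p ⊓ LinearMap.range T = (motivatedClasses n Y p').map T := by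
  refine le_antisymm (fun c hc ↦ ?_) ?_
  · obtain ⟨y, hy, hyc⟩ := exists_mem_motivatedClasses_map_eq_of_isAlgebraicCorrespondence hV hY hT hc.1 hc.2
    exact ⟨y, hy, hyc⟩
  · rintro _ ⟨y, hy, rfl⟩
    exact ⟨Ring2.Hypotheses.map_mem_motivatedClasses_of_isAlgebraicCorrespondence hV hY hT hy, LinearMap.mem_range_self T y⟩

/-! ## §4 Domination by powers: motivated classes come from motivated classes of the powers -/

section Dominated

variable {d : ℕ} {X : SchemeOver ℂ}

/-- **THE SPAN LIFT UNDER DOMINATION.** If `V` (smooth projective, dimension `m`) is dominated by the powers of `X`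
(dimension `d`) through algebraic correspondences (`HodgeTheory.IsDominatedByPowers m V d X`, Arapura's Lemma 1.1 in
algebraic form), then every motivated class of `V` is a finite sum `Σ Tᵢ(yᵢ)` with `Tᵢ : H^{2pᵢ'}(X^{eᵢ}(ℂ)) → H^{2p}(V(ℂ))`
algebraic correspondences and `yᵢ ∈ A_mot^{pᵢ'}(X^{eᵢ})_ℂ` MOTIVATED. (In print: `[V]` is a direct summand of
`⊕[X^{eᵢ}](jᵢ)` in `M_A(X)`, André's category being semisimple.) Proof: `W :=` the span of such `Tᵢ(yᵢ)` is
`≤ A_motᵖ(V)`; a motivated `b` of complementary codimension orthogonal to `W` is orthogonal to every range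
`T(H(X^e))` (§2; a correspondence into `H^{2p}` has even source degree), i.e. to all of `H^{2p}(V(ℂ))` by domination,
so `A_motᵖ(V) ≤ W^⊥⊥ = W`. [cite: Arapura2006, §1 Lemma 1.1 and §4 proof of Lemma 4.2]
[cite: Andre1996Motifs, Thm. 0.4 (p. 7) and Prop. 3.3 (pp. 21–22)] -/
theorem motivatedClasses_le_span_of_isDominatedByPowers (hV : IsSmoothProjective m V) (hX : IsSmoothProjective d X)
    (hdom : IsDominatedByPowers m V d X) (p : ℕ) :
    motivatedClasses m V p ≤
      Submodule.span ℂ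
        {c : complexBetti V (2 * p) |
          ∃ (e p' : ℕ) (T : complexBetti (X.pow e) (2 * p') →ₗ[ℂ] complexBetti V (2 * p))
            (y : complexBetti (X.pow e) (2 * p')),
            IsAlgebraicCorrespondence m (e * d) V (X.pow e) T ∧ y ∈ motivatedClasses (e * d) (X.pow e) p' ∧
              c = T y} := by
  classical
  intro c hc
  by_cases hpm : m < p
  · haveI := subsingleton_complexBetti hV (show 2 * m < 2 * p by omega)
    rw [Subsingleton.elim c 0]
    exact Submodule.zero_mem _
  obtain ⟨r, hpr⟩ : ∃ r, p + r = m := ⟨m - p, by omega⟩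
  set W := Submodule.span ℂ
        {c : complexBetti V (2 * p) |
          ∃ (e p' : ℕ) (T : complexBetti (X.pow e) (2 * p') →ₗ[ℂ] complexBetti V (2 * p))
            (y : complexBetti (X.pow e) (2 * p')),
            IsAlgebraicCorrespondence m (e * d) V (X.pow e) T ∧ y ∈ motivatedClasses (e * d) (X.pow e) p' ∧
              c = T y} with hWdef
  have hWle : W ≤ motivatedClasses m V p := by
    refine Submodule.span_le.2 ?_
    rintro _ ⟨e, p', T, y, hT, hy, rfl⟩
    exact Ring2.Hypotheses.map_mem_motivatedClasses_of_isAlgebraicCorrespondence hV (hX.pow e) hT hy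
  haveI := finite_complexBetti hV (2 * p)
  haveI := finite_complexBetti hV (2 * r)
  haveI := finite_complexBetti hV (2 * m)
  obtain ⟨hD₁, hD₂⟩ := nondegenerate_motivatedClasses hV hpr
  refine mem_of_forall_orthogonal (Ring2.Hypotheses.finrank_complexBetti_top hV)
    (cupProduct (show 2 * p + 2 * r = 2 * m by omega)) (motivatedClasses m V p) (motivatedClasses m V r) hD₁ hD₂
    hWle hc fun b hb hbW ↦ ?_
  -- `b` is orthogonal to every range of an algebraic correspondence from a power of `X`, i.e. to `H^{2p}(V(ℂ))`
  have hc' : c ∈ Submodule.span ℂ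
      {c : complexBetti V (2 * p) |
        ∃ (e a : ℕ) (T : complexBetti (X.pow e) a →ₗ[ℂ] complexBetti V (2 * p)),
          IsAlgebraicCorrespondence m (e * d) V (X.pow e) T ∧ c ∈ LinearMap.range T} := by
    rw [hdom (2 * p)]
    exact Submodule.mem_top
  have hker : c ∈ LinearMap.ker ((cupProduct (show 2 * p + 2 * r = 2 * m by omega)).flip b) := by
    refine (Submodule.span_le.2 ?_) hc'
    rintro c' ⟨e, a, T, hT, ⟨y₀, rfl⟩⟩
    -- the source degree is even
    have hpar : ∃ p', a = 2 * p' := by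
      obtain ⟨-, -, -, -, e', -, hab', -⟩ := hT
      exact ⟨a / 2, by omega⟩
    obtain ⟨p', rfl⟩ := hpar
    rw [SetLike.mem_coe, LinearMap.mem_ker, LinearMap.flip_apply]
    exact cupProduct_corrClassAction_eq_zero_of_forall_motivated hV (hX.pow e) hpr hT hb
      (fun y hy ↦ hbW _ (Submodule.subset_span ⟨e, p', T, y, hT, hy, rfl⟩)) y₀
  rwa [LinearMap.mem_ker, LinearMap.flip_apply] at hker

/-- **ARAPURA'S LEMMA 4.2 FOR THE CLAUSE «`A_mot = A`» (real carriers, kernel theorem).** If `V` is dominated by the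
powers of `X` and on every cartesian power `X^e` (dimension `e·d`) every motivated class is algebraic, then every
motivated class of `V` is algebraic: by the span lift it is `Σ Tᵢ(yᵢ)` with `yᵢ` motivated on `X^{eᵢ}`, hence
algebraic, and algebraic correspondences preserve algebraic classes (Voisin II Prop. 9.21 with (10.7), the tree's
`AbelianAll.map_mem_algebraicClasses_of_isAlgebraicCorrespondence`). The hypothesis on the powers is NOT asserted.
[cite: Arapura2006, §4 Lemma 4.2 and §1 Lemma 1.1] [cite: VoisinHodgeII2003, §9.2.4 Prop. 9.20–9.21 and (10.7)] -/
theorem motivatedClasses_le_algebraicClasses_of_isDominatedByPowers (hV : IsSmoothProjective m V)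
    (hX : IsSmoothProjective d X) (hdom : IsDominatedByPowers m V d X)
    (hpow : ∀ e p' : ℕ, motivatedClasses (e * d) (X.pow e) p' ≤ algebraicClasses (X.pow e) p') (p : ℕ) :
    motivatedClasses m V p ≤ algebraicClasses V p := by
  refine (motivatedClasses_le_span_of_isDominatedByPowers hV hX hdom p).trans (Submodule.span_le.2 ?_)
  rintro _ ⟨e, p', T, y, hT, hy, rfl⟩
  exact Ring2.AbelianAll.map_mem_algebraicClasses_of_isAlgebraicCorrespondence hV (hX.pow e) hT (hpow e p' hy)

/-- **On a zero-dimensional smooth projective `Z` every motivated class is algebraic**: in codimension `0` every class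
is algebraic (`algebraicClasses_zero`), and `A_motᵖ(Z) = 0` for `p > 0 = dim Z` (`motivatedClasses_eq_bot_of_lt`).
Used for the power `X⁰ = Spec ℂ`. [cite: Andre1996Motifs, §2.1 Déf. 1 (p. 14)] -/
theorem motivatedClasses_le_algebraicClasses_of_dim_zero {Z : SchemeOver ℂ} (p : ℕ) :
    motivatedClasses 0 Z p ≤ algebraicClasses Z p := by
  rcases Nat.eq_zero_or_pos p with rfl | hp
  · rw [algebraicClasses_zero]
    exact le_top
  · rw [motivatedClasses_eq_bot_of_lt hp]
    exact bot_le

/-- **Positive-powers form** of `motivatedClasses_le_algebraicClasses_of_isDominatedByPowers`: it suffices that the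
motivated classes of the POSITIVE powers `X^{k+1}` be algebraic (`X⁰ = Spec ℂ` is covered by
`motivatedClasses_le_algebraicClasses_of_dim_zero`). [cite: Arapura2006, §4 Lemma 4.2 and §1 Lemma 1.1] -/
theorem motivatedClasses_le_algebraicClasses_of_isDominatedByPowers_succ (hV : IsSmoothProjective m V)
    (hX : IsSmoothProjective d X) (hdom : IsDominatedByPowers m V d X)
    (hpow : ∀ k p' : ℕ, motivatedClasses ((k + 1) * d) (X.pow (k + 1)) p' ≤ algebraicClasses (X.pow (k + 1)) p')
    (p : ℕ) : motivatedClasses m V p ≤ algebraicClasses V p := by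
  refine motivatedClasses_le_algebraicClasses_of_isDominatedByPowers hV hX hdom (fun e p' ↦ ?_) p
  cases e with
  | zero =>
    rw [Nat.zero_mul]
    exact motivatedClasses_le_algebraicClasses_of_dim_zero p'
  | succ k => exact hpow k p'

end Dominated

end Summit.HodgeConjecture.HodgeConjecture.Theorems

end
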